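import Summits.SmoothPoincare4.SmoothPoincare4.Theorems.ConvexBisectionAcyclicBisectionExistsDualHandlePushTubeImage
import Summits.SmoothPoincare4.SmoothPoincare4.Theorems.ConvexBisectionAcyclicBisectionExistsDualHandleSeamModelDual
import HarnessLib

/-!
# The seam page function, IV-a: tube points on the boundary and the pushed attaching circle
(preparatory lemmas for brick X5-1 "page-angle agreement" of clause (ii) "the seam page function"
of the registered stub `stub_T3_dualPresentation` (T3), line `modp-braid-orbits`, crux
`ConvexBisection.AcyclicBisectionExists`, item stmt-SmoothPoincare4-10508; wave 5, lead c5)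

* `norm_eq_one_of_apply_mem_boundary` — an attaching map `q̄ : T → M` sends only sphere points to `∂M`;
* `pFun_zero_mem`, `handleInversion_selfPush_circle` — the pushed attaching circle `α (selfPush t)`,
  `t ∈ S`, is the interior circle `C` (`μ`-part `0`, norm `< 1`; Z3's `selfPush_of_mem_circle`);
* `lamSq_tubeVec_lt_one_of_ne`, `norm_dualVec_eq_one` — bookkeeping on `T ∩ ∂D⁴`.

Everything here is proved; no named facts, no `def`.

## References
* A. A. Kosinski, *Differential Manifolds* (1993), VI §6. [Kosinski1993]
-/

noncomputable section

-- the prescribed namespace `Summit.<P>.<Sub>.…` duplicates `SmoothPoincare4` (P = Sub)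
set_option linter.dupNamespace false

open scoped Manifold ContDiff Topology

namespace Summit.SmoothPoincare4.SmoothPoincare4.Theorems.AcyclicBisectionExists.ModpBraidOrbits

open Set Function Metric
open Literature.Topology.FourManifolds Literature.Topology.FourManifolds.HandleAttachingMap
open PushModel

/-! ### §1 Two small facts: tube points on the boundary, and the push of the attaching circle -/

section Prep

/-- **An attaching map sends only sphere points to the boundary**: `q̄ t ∈ ∂M ⇒ ‖t‖ = 1`.
[cite: Kosinski1993, VI §6] -/
theorem norm_eq_one_of_apply_mem_boundary {M : Type*} [TopologicalSpace M]
    [ChartedSpace (EuclideanHalfSpace 4) M] [IsManifold (𝓡∂ 4) ∞ M] (q : HandleAttachingMap 3 2 M)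
    (t : ↥(handleTube 3 2)) (ht : q.toFun t ∈ (𝓡∂ 4).boundary M) :
    ‖((t : closedBall (0 : EuclideanSpace ℝ (Fin 4)) 1) : EuclideanSpace ℝ (Fin 4))‖ = 1 := by
  have h1 : t ∈ (𝓡∂ 4).boundary ↥(handleTube 3 2) :=
    (mem_boundary_iff_of_isSmoothEmbedding q.isSmoothEmbedding q.isOpen_range t).1 ht
  have h2 : (t : closedBall (0 : EuclideanSpace ℝ (Fin 4)) 1) ∈
      (𝓡∂ 4).boundary (closedBall (0 : EuclideanSpace ℝ (Fin 4)) 1) :=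
    (mem_boundary_opens_iff (handleTube 3 2) t).1 h1
  rw [boundary_closedBall] at h2
  exact h2

variable {κ δ : ℝ}

/-- `pFun κ 0 = κ²/8 ∈ (0, 1)` for `0 < κ ≤ 1/2`. [folklore] -/
theorem pFun_zero_mem (hκ : 0 < κ) (hκ2 : κ ≤ 1 / 2) : 0 < pFun κ 0 ∧ pFun κ 0 < 1 := by
  refine ⟨pFun_pos hκ le_rfl, ?_⟩
  have h1 := (coreCut_mem 0).1
  have h2 : κ ^ 2 ≤ 1 / 4 := by nlinarith
  unfold pFun
  nlinarith

/-- **The pushed attaching circle is the interior circle `C`**: for `t ∈ S` (`‖t_λ‖² = 1`),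
`α (selfPush t)` has `μ`-part `0` and norm `< 1`. [folklore] -/
theorem handleInversion_selfPush_circle (hκ : 0 < κ) (hκ2 : κ ≤ 1 / 2) (hδ : 0 < δ)
    {t : EuclideanSpace ℝ (Fin 4)} (ht : ‖t‖ ≤ 1) (hS : lamSq 2 t = 1) :
    muPart (handleInversion 2 (selfPush κ δ t)) = 0 ∧ ‖handleInversion 2 (selfPush κ δ t)‖ < 1 := by
  have hl : ‖lamPart t‖ = 1 := by
    have h := norm_lamPart_sq t
    rw [hS] at h
    nlinarith [norm_nonneg (lamPart t)]
  have hm : muPart t = 0 := by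
    have h := norm_sq_eq_lamPart_muPart t
    rw [hl] at h
    have h' : ‖muPart t‖ ^ 2 ≤ 0 := by nlinarith [norm_nonneg t]
    exact norm_eq_zero.1 (by nlinarith [norm_nonneg (muPart t)])
  obtain ⟨hp0, hp1⟩ := pFun_zero_mem hκ hκ2
  set v := selfPush κ δ t with hv
  have hv' : v = Real.sqrt (1 - pFun κ 0) • lamEmbed (lamPart t) := selfPush_of_mem_circle hκ hκ2 hδ hl hm
  have hlv : lamSq 2 v = 1 - pFun κ 0 := by
    rw [← norm_lamPart_sq, hv', lamPart_smul, lamPart_lamEmbed, norm_smul, mul_pow,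
      Real.norm_of_nonneg (Real.sqrt_nonneg _), Real.sq_sqrt (by linarith), hl]
    ring
  have hmv : muPart v = 0 := by rw [hv', muPart_smul, muPart_lamEmbed, smul_zero]
  have h0 : 0 < lamSq 2 v := by rw [hlv]; linarith
  have h1 : lamSq 2 v < 1 := by rw [hlv]; linarith
  refine ⟨by rw [muPart_handleInversion, hmv, smul_zero], ?_⟩
  have hsq : ‖handleInversion 2 v‖ ^ 2 = pFun κ 0 := by
    rw [norm_handleInversion_sq h0 h1, ← norm_muPart_sq, hmv, norm_zero, hlv]
    ring
  nlinarith [norm_nonneg (handleInversion 2 v)]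


/-- Off `S`, the `λ`-level of a tube point is `< 1`. [folklore] -/
theorem lamSq_tubeVec_lt_one_of_ne (y : ↥(handleTube 3 2)) (hy : lamSq 2 (tubeVec y) ≠ 1) :
    lamSq 2 (tubeVec y) < 1 := by
  refine lt_of_le_of_ne ?_ hy
  have h1 := norm_tubeVec_le_one y
  have h2 := lamSq_add_muSq 2 (tubeVec y)
  nlinarith [muSq_nonneg 2 (tubeVec y), norm_nonneg (tubeVec y)]

variable {aC : ℝ}

/-- On `T ∩ ∂D⁴` the dual vector has norm `1`. [folklore] -/
theorem norm_dualVec_eq_one (ha : 0 < aC) (hκ : 0 < κ) (hκ1 : κ ≤ 1) (hδ : 0 < δ) (hδ2 : δ ≤ 1 / 2)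
    (y : ↥(handleTube 3 2)) (hd : tubeDepth y = 0) : ‖dualVec aC κ δ y‖ = 1 := by
  have h := norm_dualVec_sq ha hκ hκ1 hδ hδ2 y (a := aC)
  rw [hd, mul_zero] at h
  simp only [gProfile, mul_zero, zero_div, add_zero] at h
  nlinarith [norm_nonneg (dualVec aC κ δ y)]

end Prep

/-! ### Registered helper -/

/-- **Registered helper `helper_handleInversion_selfPush_circle` (sub-goal of `stub_T3_dualPresentation`,
T3 clause (ii), brick X5-1 prep, wave 5, lead c5): the pushed attaching circle is the interior circle
`C`** — for `t ∈ S`, `α (selfPush κ δ t)` has `μ`-part `0` and norm `< 1`. [cite: Kosinski1993, VI §6] -/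
theorem helper_handleInversion_selfPush_circle : ∀ {κ δ : ℝ}, 0 < κ → κ ≤ 1 / 2 → 0 < δ → ∀ {t : EuclideanSpace ℝ (Fin 4)}, ‖t‖ ≤ 1 → Literature.Topology.FourManifolds.lamSq 2 t = 1 → Literature.Topology.FourManifolds.muPart (Literature.Topology.FourManifolds.handleInversion 2 (Summit.SmoothPoincare4.SmoothPoincare4.Theorems.AcyclicBisectionExists.ModpBraidOrbits.PushModel.selfPush κ δ t)) = 0 ∧ ‖Literature.Topology.FourManifolds.handleInversion 2 (Summit.SmoothPoincare4.SmoothPoincare4.Theorems.AcyclicBisectionExists.ModpBraidOrbits.PushModel.selfPush κ δ t)‖ < 1 :=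
  fun hκ hκ2 hδ _ ht hS => handleInversion_selfPush_circle hκ hκ2 hδ ht hS

end Summit.SmoothPoincare4.SmoothPoincare4.Theorems.AcyclicBisectionExists.ModpBraidOrbits

end
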